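import Mathlib
import HarnessLib
import Summits.HubbardSuperconductivity.HubbardSuperconductivity.Theorems.KLProgrammeKLRegimeSplitBundleV12
import Summits.HubbardSuperconductivity.HubbardSuperconductivity.Theorems.KLProgrammeKLRegimeEngineSlotReduction
import Summits.HubbardSuperconductivity.HubbardSuperconductivity.Theorems.KLProgrammeKLRegimeVolumeLimitCauchy

/-!
# Route `KLProgramme` — crux K3, ENGINE child (gen 3 `KLRegimeEngineV11` stmt-HubbardSuperconductivity-19823 / gen-4 twin on `klPredsV12`):
# ONE value clause of the engine slot is NOT OWED — (E2′-S3) `QuarticValueIncrementAtS3` follows from (E2″-v6) `PairValueIncrementAtV6`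
# at every scale; the V8S slot from FOUR analytic clauses at `1 ≤ n` and at `n = 0`
# (cell gate-hubbard-kl, seat hubbard-kl-k3c2-p2 «thermal-bar induction n ≤ nScales β + 1 with EngineBoundsAtV4S sums», g3)

The two (T)/(D)-carrying VALUE-INCREMENT clauses of the engine slot of record (`EngineBoundsAtV8S`, `…SplitBundleV12`; their budget is
`gainBar + eremBar (n−1) + thermalBar n + legDressBarQ·legSliceCountT`) are
* (E2″-v6) `PairValueIncrementAtV6 … n`: `‖𝒞_n(Q;k,k′) − 𝒞_{n−1}(Q;k,k′)‖ ≤ gainBar n (|Q|_𝕋, |k−k′|_𝕋, |k+k′−Q|_𝕋) + … + legDressBarQ·#(k′, Q−k′, Q−k, k)`,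
* (E2′-S3) `QuarticValueIncrementAtS3 … n`: `‖λ_n^{↑↓}(k₁,k₂,k₃) − λ_{n−1}^{↑↓}(k₁,k₂,k₃)‖ ≤ gainBar n (|k₁+k₃|_𝕋, |k₁−k₂|_𝕋, |k₂−k₃|_𝕋) + … +
  legDressBarQ·#(k₁, k₂, k₃, k₁−k₂+k₃)`.
Since the `↑↓` running coupling value IS a pair-array entry — `λ_n^{↑↓}(k₁,k₂,k₃) = 𝒞_n(k₁+k₃; k₂, k₁)` (`klka_quarticValue_eq_pairAmplitude`,
`…SplitValueIdentification`, an even leg permutation) — the second clause is the first one READ AT `(Q, k, k′) := (k₁+k₃, k₂, k₁)`: the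
transfers agree (`|k₂−k₁|_𝕋 = |k₁−k₂|_𝕋` by `klvr_klTorusNorm_sub_comm`, `k₂+k₁−(k₁+k₃) = k₂−k₃`) and the leg tuples `(k₁, k₃, k₁−k₂+k₃, k₂)` /
`(k₁, k₂, k₃, k₁−k₂+k₃)` are a permutation of each other, under which the crossing-leg count `legSliceCountT` is invariant
(`klvr_legSliceCountT_eq_of_perm_0231`).  Results:
* §1 torus dictionary (with k3c4-p1's `klvc_torusAbs_neg`): `klvr_torusAbs_add_int_mul`, `klvr_latticeMomentum_neg`, **`klvr_klTorusNorm_neg`**,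
  **`klvr_klTorusNorm_sub_comm`**; `klvr_legSliceCountT_comp_perm`, `klvr_legSliceCountT_eq_of_perm_0231`;
* §2 **`klvr_quarticValueIncrementAtS3_of_pairValueIncrementAtV6`** (every `n`; both clauses are vacuous at `n = 0`);
* §3 the V8S slot from its analytic clauses: **`klvr_engineBoundsAtV8S_of_pos`** (`1 ≤ n`: (E1-v4), (E2-v8), (E2″-v6), (E4), (E5-S) ⟹ slot —
  (E0) is `selfEnergySymmetric_all`, (E2′-S3) is §2, (E2′-S2 UV) is vacuous), `klvr_engineBoundsAtV8S_iff_of_pos`, **`klvr_stepValuesConj_of_reduced`**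
  (the registered `stub_engine_step_values` concludes `PairLadderStepAtV8 ∧ PairValueIncrementAtV6 ∧ QuarticValueIncrementAtS3 ∧ EngineFirstMoments ∧
  IsoTupleL1AtS` at `n`; that five-clause conjunction from the FOUR clauses without (E2′-S3)), and the scale-`0` twins on the V8S slot
  (`klvr_engineBoundsAtV8S_zero_of`, `klvr_scaleZeroConjV8_of_reduced`: p3's `engineScaleZeroConj_of` transported through
  `pairLadderStepAtV8_iff_V7_zero`), `klvr_engineBoundsAtV8S_of_clauses` (uniform in `n`).
Pure bookkeeping over landed definitions; nothing about the model is asserted.  0 kit.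
-/

noncomputable section

namespace Summit.HubbardSuperconductivity.HubbardSuperconductivity.Theorems.KLRegimeSplit

set_option linter.dupNamespace false -- summit = problem name (single-conjunct summit), D-0017

open Real Finset Literature.MathematicalPhysics.QuantumLattice Literature.Probability.LatticeModels
open Summit.HubbardSuperconductivity.HubbardSuperconductivity.Theorems.KLProgrammeLegKernels

/-! ## §1 Torus dictionary: evenness of the torus size, permutation invariance of the crossing-leg count -/

/-- `|x + 2πm|_𝕋 = |x|_𝕋`. -/
theorem klvr_torusAbs_add_int_mul (x : ℝ) (m : ℤ) : torusAbs (x + m * (2 * Real.pi)) = torusAbs x := by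
  unfold torusAbs
  rw [← zsmul_eq_mul, toIocMod_add_zsmul]

section Torus

variable {L : ℕ} [NeZero L]

/-- **Lattice momenta of a negative**: `p(−k)_i = −p(k)_i + m·2π` for an integer `m` (the representatives `val ∈ [0, L)` of `k i` and
`−k i` sum to a multiple of `L`). -/
theorem klvr_latticeMomentum_neg (k : TorusSite 2 L) (i : Fin 2) :
    ∃ m : ℤ, latticeMomentum L (-k) i = -latticeMomentum L k i + m * (2 * Real.pi) := by
  have hL : (L : ℝ) ≠ 0 := by exact_mod_cast NeZero.ne L
  have hdvd : (L : ℤ) ∣ (((-k) i).val : ℤ) - (-((k i).val : ℤ)) := by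
    rw [← ZMod.intCast_eq_intCast_iff_dvd_sub]
    push_cast
    rw [ZMod.natCast_zmod_val, ZMod.natCast_zmod_val, Pi.neg_apply]
  obtain ⟨m, hm⟩ := hdvd
  refine ⟨m, ?_⟩
  have hm' : ((((-k) i).val : ℕ) : ℝ) = -((k i).val : ℝ) + (m : ℝ) * L := by
    have := congrArg (fun t : ℤ => (t : ℝ)) hm
    push_cast at this
    linarith
  simp only [latticeMomentum]
  rw [hm']
  field_simp

/-- **The torus size is even**: `|−k|_𝕋 = |k|_𝕋`. -/
theorem klvr_klTorusNorm_neg (k : TorusSite 2 L) : klTorusNorm L (-k) = klTorusNorm L k := by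
  unfold klTorusNorm torusSupNorm
  obtain ⟨m₀, h₀⟩ := klvr_latticeMomentum_neg k 0
  obtain ⟨m₁, h₁⟩ := klvr_latticeMomentum_neg k 1
  simp only
  rw [h₀, h₁, klvr_torusAbs_add_int_mul, klvr_torusAbs_add_int_mul, klvc_torusAbs_neg, klvc_torusAbs_neg]

/-- **`|k − k′|_𝕋 = |k′ − k|_𝕋`**. -/
theorem klvr_klTorusNorm_sub_comm (k k' : TorusSite 2 L) : klTorusNorm L (k - k') = klTorusNorm L (k' - k) := by
  rw [← neg_sub, klvr_klTorusNorm_neg]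

omit [NeZero L] in
/-- **Permutation invariance of the crossing-leg count**: relabelling the four legs does not change how many of them cross slice `n`. -/
theorem klvr_legSliceCountT_comp_perm (β μ : ℝ) (K : TrigPolyC4v) (n : ℕ) (σ : Equiv.Perm (Fin 4)) (k : Fin 4 → TorusSite 2 L) :
    legSliceCountT L β μ K n (k ∘ σ) = legSliceCountT L β μ K n k := by
  unfold legSliceCountT
  rw [← Finset.card_map σ.toEmbedding]
  congr 1
  ext j
  simp only [Finset.mem_map_equiv, Finset.mem_filter, Finset.mem_univ, true_and, Function.comp_apply,
    Equiv.apply_symm_apply]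

omit [NeZero L] in
/-- The instance used below: `#(k₁, k₃, k₄, k₂) = #(k₁, k₂, k₃, k₄)`. -/
theorem klvr_legSliceCountT_eq_of_perm_0231 (β μ : ℝ) (K : TrigPolyC4v) (n : ℕ) (k₁ k₂ k₃ k₄ : TorusSite 2 L) :
    legSliceCountT L β μ K n ![k₁, k₃, k₄, k₂] = legSliceCountT L β μ K n ![k₁, k₂, k₃, k₄] := by
  have hperm : (![k₁, k₃, k₄, k₂] : Fin 4 → TorusSite 2 L) =
      (![k₁, k₂, k₃, k₄] : Fin 4 → TorusSite 2 L) ∘ ⇑(Equiv.swap (1 : Fin 4) 2 * Equiv.swap (2 : Fin 4) 3) := by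
    funext i
    fin_cases i <;> rfl
  rw [hperm, klvr_legSliceCountT_comp_perm]

end Torus

/-! ## §2 (E2′-S3) from (E2″-v6) -/

section Model

variable {L M : ℕ} [NeZero L] [NeZero M]

/-- **(E2′-S3) `QuarticValueIncrementAtS3 … n` follows from (E2″-v6) `PairValueIncrementAtV6 … n`** at every scale `n`: the `↑↓`
value increment at `(k₁, k₂, k₃)` is the pair-array increment at total momentum `k₁ + k₃` read at `(k₂, k₁)`, with the same three
transfers and the same crossing-leg count. -/
theorem klvr_quarticValueIncrementAtS3_of_pairValueIncrementAtV6 {G : GeoConsts} {P : SplitConsts} {Q : EngConsts} {β U μ : ℝ}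
    {K : TrigPolyC4v} {n : ℕ} (h : PairValueIncrementAtV6 L M G P Q β U μ K n) :
    QuarticValueIncrementAtS3 L M G P Q β U μ K n := by
  intro hn k₁ hk₁ k₂ hk₂ k₃ hk₃
  have h1 := h hn (k₁ + k₃) k₂ hk₂ k₁ hk₁
  rw [klka_quarticValue_eq_pairAmplitude, klka_quarticValue_eq_pairAmplitude]
  have e1 : k₂ + k₁ - (k₁ + k₃) = k₂ - k₃ := by abel
  have e2 : k₁ + k₃ - k₁ = k₃ := by abel
  have e3 : k₁ + k₃ - k₂ = k₁ - k₂ + k₃ := by abel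
  rw [e1, e2, e3, klvr_klTorusNorm_sub_comm k₂ k₁, klvr_legSliceCountT_eq_of_perm_0231] at h1
  exact h1

/-! ## §3 The V8S engine slot from its analytic clauses -/

/-- **The engine slot of record at a scale `1 ≤ n` from FOUR + ONE analytic clauses**: (E1-v4), (E2-v8), (E2″-v6), (E4), (E5-S) ⟹
`EngineBoundsAtV8S … n` — (E0) is `selfEnergySymmetric_all`, (E2′-S3) is `klvr_quarticValueIncrementAtS3_of_pairValueIncrementAtV6`,
(E2′-S2 UV) is vacuous at `1 ≤ n`. -/
theorem klvr_engineBoundsAtV8S_of_pos {G : GeoConsts} {P : SplitConsts} {Q : EngConsts} {β U μ : ℝ} {K : TrigPolyC4v} {n : ℕ}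
    (hn : 1 ≤ n) (hE1 : KernelNormsV4 L M P Q β U μ K n) (hE2 : PairLadderStepAtV8 L M G P Q β U μ K n)
    (hE2'' : PairValueIncrementAtV6 L M G P Q β U μ K n)
    (hE4 : EngineFirstMoments L M G P Q β U μ K n) (hE5 : IsoTupleL1AtS L M G P β U μ K n) :
    EngineBoundsAtV8S L M G P Q β U μ K n :=
  ⟨selfEnergySymmetric_all L M β U μ K n, hE1, hE2, hE2'', klvr_quarticValueIncrementAtS3_of_pairValueIncrementAtV6 hE2'',
    fun h0 => absurd h0 (by omega), hE4, hE5⟩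

/-- **`EngineBoundsAtV8S … n` ⟺ its FIVE analytic clauses at `1 ≤ n`** ((E0), (E2′-S3) and (E2′-S2 UV) drop out). -/
theorem klvr_engineBoundsAtV8S_iff_of_pos (G : GeoConsts) (P : SplitConsts) (Q : EngConsts) (β U μ : ℝ) (K : TrigPolyC4v) {n : ℕ}
    (hn : 1 ≤ n) :
    EngineBoundsAtV8S L M G P Q β U μ K n ↔
      KernelNormsV4 L M P Q β U μ K n ∧ PairLadderStepAtV8 L M G P Q β U μ K n ∧ PairValueIncrementAtV6 L M G P Q β U μ K n ∧
        EngineFirstMoments L M G P Q β U μ K n ∧ IsoTupleL1AtS L M G P β U μ K n := by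
  constructor
  · exact fun h => ⟨h.2.1, h.2.2.1, h.2.2.2.1, h.2.2.2.2.2.2.1, h.2.2.2.2.2.2.2⟩
  · exact fun h => klvr_engineBoundsAtV8S_of_pos hn h.1 h.2.1 h.2.2.1 h.2.2.2.1 h.2.2.2.2

/-- **The registered stub's shape at the inductive scales** (`stub_engine_step_values` of the engine skeleton on stmt-…-19823 and of its
gen-4 port concludes `PairLadderStepAtV8 … n ∧ PairValueIncrementAtV6 … n ∧ QuarticValueIncrementAtS3 … n ∧ EngineFirstMoments … n ∧
IsoTupleL1AtS … n`): that five-clause conjunction from the FOUR clauses without (E2′-S3) — the `↑↓` value-increment clause is not owed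
separately. -/
theorem klvr_stepValuesConj_of_reduced {G : GeoConsts} {P : SplitConsts} {Q : EngConsts} {β U μ : ℝ} {K : TrigPolyC4v} {n : ℕ}
    (hE2 : PairLadderStepAtV8 L M G P Q β U μ K n) (hE2'' : PairValueIncrementAtV6 L M G P Q β U μ K n)
    (hE4 : EngineFirstMoments L M G P Q β U μ K n) (hE5 : IsoTupleL1AtS L M G P β U μ K n) :
    PairLadderStepAtV8 L M G P Q β U μ K n ∧ PairValueIncrementAtV6 L M G P Q β U μ K n ∧
      QuarticValueIncrementAtS3 L M G P Q β U μ K n ∧ EngineFirstMoments L M G P Q β U μ K n ∧ IsoTupleL1AtS L M G P β U μ K n :=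
  ⟨hE2, hE2'', klvr_quarticValueIncrementAtS3_of_pairValueIncrementAtV6 hE2'', hE4, hE5⟩

/-- **The scale-`0` rung of the V8S slot from its four analytic clauses**: (E1-v4)₀, the pair-amplitude ultraviolet clause, (E4)₀, (E5-S)₀
⟹ `EngineBoundsAtV8S … 0` (p3's `engineBoundsAtV7S_zero_of` transported through `engineBoundsAtV8S_iff_V7S_zero`). -/
theorem klvr_engineBoundsAtV8S_zero_of {G : GeoConsts} {P : SplitConsts} {Q : EngConsts} {β U μ : ℝ} {K : TrigPolyC4v}
    (hE1 : KernelNormsV4 L M P Q β U μ K 0)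
    (hUV : ∀ Qm : TorusSite 2 L, ∀ k ∈ klBall L μ K, ∀ k' ∈ klBall L μ K,
      ‖klPairAmplitude L M β U μ K 0 Qm k k' - (U : ℂ)‖ ≤ initDevBar G U + legDressBarQ G P Q U 0 4)
    (hE4 : EngineFirstMoments L M G P Q β U μ K 0) (hE5 : IsoTupleL1AtS L M G P β U μ K 0) :
    EngineBoundsAtV8S L M G P Q β U μ K 0 :=
  (engineBoundsAtV8S_iff_V7S_zero L M G P Q β U μ K).2 (engineBoundsAtV7S_zero_of hE1 hUV hE4 hE5)

/-- **The registered stub's shape at scale `0` on the V8S slot** (`stub_engine_scale0` concludes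
`KernelNormsV4 … 0 ∧ PairLadderStepAtV8 … 0 ∧ QuarticValueUVAtS2 … 0 ∧ EngineFirstMoments … 0 ∧ IsoTupleL1AtS … 0`): that five-clause
conjunction from the FOUR analytic clauses — the ultraviolet values clause is not owed separately (p3's `engineScaleZeroConj_of`, V8 token). -/
theorem klvr_scaleZeroConjV8_of_reduced {G : GeoConsts} {P : SplitConsts} {Q : EngConsts} {β U μ : ℝ} {K : TrigPolyC4v}
    (hE1 : KernelNormsV4 L M P Q β U μ K 0)
    (hUV : ∀ Qm : TorusSite 2 L, ∀ k ∈ klBall L μ K, ∀ k' ∈ klBall L μ K,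
      ‖klPairAmplitude L M β U μ K 0 Qm k k' - (U : ℂ)‖ ≤ initDevBar G U + legDressBarQ G P Q U 0 4)
    (hE4 : EngineFirstMoments L M G P Q β U μ K 0) (hE5 : IsoTupleL1AtS L M G P β U μ K 0) :
    KernelNormsV4 L M P Q β U μ K 0 ∧ PairLadderStepAtV8 L M G P Q β U μ K 0 ∧ QuarticValueUVAtS2 L M G P Q β U μ K 0 ∧
      EngineFirstMoments L M G P Q β U μ K 0 ∧ IsoTupleL1AtS L M G P β U μ K 0 :=
  ⟨hE1, (pairLadderStepAtV8_iff_V7_zero L M G P Q β U μ K).2 ((pairLadderStepAtV7_zero_iff G P Q β U μ K).2 hUV),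
    quarticValueUVAtS2_zero_of_pairAmplitudeUVClause hUV, hE4, hE5⟩

/-- (E2′-S2 UV) from (E2-v8): the `n = 0` conjuncts of the two pair-ladder clauses coincide. -/
theorem klvr_quarticValueUVAtS2_of_pairLadderStepAtV8 {G : GeoConsts} {P : SplitConsts} {Q : EngConsts} {β U μ : ℝ} {K : TrigPolyC4v}
    {n : ℕ} (h : PairLadderStepAtV8 L M G P Q β U μ K n) : QuarticValueUVAtS2 L M G P Q β U μ K n := by
  intro h0
  subst h0
  exact quarticValueUVAtS2_zero_of_pairAmplitudeUVClause (h.1 rfl) rfl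

/-- **At every scale, (E0), (E2′-S3) and (E2′-S2 UV) are never owed**: `EngineBoundsAtV8S … n` from the five remaining clauses, uniformly
in `n` (the form a strong induction over the scale ladder `n ≤ nScales β + 1` reads). -/
theorem klvr_engineBoundsAtV8S_of_clauses {G : GeoConsts} {P : SplitConsts} {Q : EngConsts} {β U μ : ℝ} {K : TrigPolyC4v} {n : ℕ}
    (hE1 : KernelNormsV4 L M P Q β U μ K n) (hE2 : PairLadderStepAtV8 L M G P Q β U μ K n)
    (hE2'' : PairValueIncrementAtV6 L M G P Q β U μ K n)
    (hE4 : EngineFirstMoments L M G P Q β U μ K n) (hE5 : IsoTupleL1AtS L M G P β U μ K n) :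
    EngineBoundsAtV8S L M G P Q β U μ K n :=
  ⟨selfEnergySymmetric_all L M β U μ K n, hE1, hE2, hE2'', klvr_quarticValueIncrementAtS3_of_pairValueIncrementAtV6 hE2'',
    klvr_quarticValueUVAtS2_of_pairLadderStepAtV8 hE2, hE4, hE5⟩

/-- **The slot's exact analytic content, all scales**: `EngineBoundsAtV8S … n ↔ (E1-v4) ∧ (E2-v8) ∧ (E2″-v6) ∧ (E4) ∧ (E5-S)`. -/
theorem klvr_engineBoundsAtV8S_iff (G : GeoConsts) (P : SplitConsts) (Q : EngConsts) (β U μ : ℝ) (K : TrigPolyC4v) (n : ℕ) :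
    EngineBoundsAtV8S L M G P Q β U μ K n ↔
      KernelNormsV4 L M P Q β U μ K n ∧ PairLadderStepAtV8 L M G P Q β U μ K n ∧ PairValueIncrementAtV6 L M G P Q β U μ K n ∧
        EngineFirstMoments L M G P Q β U μ K n ∧ IsoTupleL1AtS L M G P β U μ K n := by
  constructor
  · exact fun h => ⟨h.2.1, h.2.2.1, h.2.2.2.1, h.2.2.2.2.2.2.1, h.2.2.2.2.2.2.2⟩
  · exact fun h => klvr_engineBoundsAtV8S_of_clauses h.1 h.2.1 h.2.2.1 h.2.2.2.1 h.2.2.2.2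

end Model

end Summit.HubbardSuperconductivity.HubbardSuperconductivity.Theorems.KLRegimeSplit

end
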